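import Summits.QuantumFields.YangMills.Theorems.LuscherReductionDressedRitzPlateauDefs
import Summits.QuantumFields.YangMills.Theorems.LuscherReductionDressedRitzRitzAlgebra
import Summits.QuantumFields.YangMills.Theorems.LuscherReductionRunningReductionKTRCalibration
import Summits.QuantumFields.YangMills.Theorems.LuscherReductionRunningReductionKTRCertificate
import HarnessLib

/-!
# Route `LuscherReduction`, item `DressedRitz` (stmt-QuantumFields-20205) — reduction chain, file 1:
# `RitzGeneratorsAt k ↔ DressedRitzAt k` (Ritz rotation + in-span Courant–Fischer + LEMMA A), and the route decl from `∀ k, RitzGeneratorsAt k`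

Support module of the `FemtoTransferGap` group (fleet service by seat ym-infvol-p2 g6; route `LuscherReduction`, femto rung R2b1; bears on the
crux child `DressedRitz` = stmt-QuantumFields-20205 of RED stmt-QuantumFields-19978; owner ym-beyond-p1 g19 ask (β)).  CONTENT = §2–§4 of the
planner's crux workfile `Summits/QuantumFields/YangMills/Cruxes/RunningReduction/Lines/DressedRitzGEVP.lean` (rev 3, sha16 8eae6de8b30412fb, seat
ym-cruxidea-19978-1 GEN 4; kernel-checked there, farm rc 0) RE-HOMED on the Theorems side LEVEL BY LEVEL: the closed cuts `RitzGenerators`,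
`DressedRitz` of the workfile become the `k`-slices `KTGen.RitzGeneratorsAt k`, `KTGen.DressedRitzAt k` of
`Theorems/LuscherReductionDressedRitzPlateauDefs.lean` (texts byte-identical minus the leading `∀ k`), the proofs are VERBATIM minus the leading
`intro k`, and the route decl `Theses.LuscherReduction.DressedRitz` (= `∀ k, DressedRitzAt k` by `Iff.rfl`) is concluded BY NAME.

* `coe_sum_smul`, `coe_sum_smul_residual`, `coe_residual` — coercion bookkeeping `physSubmodule L → (GaugeConfig → ℝ)`.
* ★ `dressedRitzAt_of_ritzGeneratorsAt : RitzGeneratorsAt k → DressedRitzAt k` — given generators (g1)–(g4) at `(L, β)`: the Gram matrix is positive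
  definite (g1), so the span carries an `l2`-orthonormal `qform`-diagonal basis `u` with decreasing Ritz data `m` (Literature
  `exists_orthonormal_formDiagonal_antitone`); by in-span Courant–Fischer `ritzValue β v j = m_j` (tree `ritzValue_eq_ritzDiag`), so (g3) is clause (i)
  and (g4) is clause (iii) for `φ = u`; LEMMA A (`residualGram_le_of_generators`, file A) with `g = 1/2`, `n = k+1`, `ρ = max C 0 · (λ³/L²) m₀²` turns
  (g2) into the residual Gram bound (ii′) with constant `2(k+1)·max C 0`.
* `ritzGeneratorsAt_of_dressedRitzAt` (converse: a dressed Ritz family is a generator family), `ritzGeneratorsAt_iff_dressedRitzAt`.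
* ★ `dressedRitz_of_ritzGenerators : (∀ k, RitzGeneratorsAt k) → Theses.LuscherReduction.DressedRitz` and `ritzGenerators_iff_dressedRitz`.

HONEST FRAMING: fixed-lattice Rayleigh–Ritz ∕ GEVP bookkeeping on the femto rung R2b1; an EQUIVALENT re-typing of item 20205, of operational value
only (it names the correlator data a constructive-RG prover must deliver); proves nothing OF `DressedRitz`; no bearing on infinite volume, the continuum
limit or the Clay mass gap.  References: Lüscher–Wolff, NPB 339 (1990) 222 (GEVP) [cite: LuscherWolff1990]; Golub–Van Loan §8.7
[cite: GolubVanLoan2013, §8.7.1]; Reed–Simon IV XIII.1–2 [cite: ReedSimonIV1978, XIII.1].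
-/

set_option autoImplicit false

noncomputable section

open MeasureTheory Filter Topology Real
open Literature.MathematicalPhysics.QuantumFieldTheory
open Literature.MathematicalPhysics.QuantumLattice
open Literature.Analysis.OperatorTheory.YMMatrixModel
open Literature.Analysis.OperatorTheory
open Literature.Analysis.OperatorTheory.ClusterKatoTemple
open scoped BigOperators

namespace Summit.QuantumFields.YangMills.Theorems.FemtoTransferGap.KTGen

open Summit.QuantumFields.YangMills.Theorems.FemtoTransferGap
open Summit.QuantumFields.YangMills.Theorems.FemtoTransferGap.KTRCalibration
open Summit.QuantumFields.YangMills.Theorems.FemtoTransferGap.PhysL2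

/-! ## §2 Coercion bookkeeping between the physical subspace and the function space -/

variable {L : ℕ} [NeZero L]

omit [NeZero L] in
/-- The underlying function of a finite combination in the physical subspace. [folklore] -/
theorem coe_sum_smul {n : ℕ} (c : Fin n → ℝ) (V : Fin n → physSubmodule L) :
    ((∑ i, c i • V i : physSubmodule L) : GaugeConfig 3 L SU2 → ℝ) = ∑ i, c i • (V i : GaugeConfig 3 L SU2 → ℝ) := by
  rw [Submodule.coe_sum]
  refine Finset.sum_congr rfl fun i _ => ?_
  rw [Submodule.coe_smul]

/-- The underlying function of a finite combination of packaged residuals `K u_i − m_i u_i`. [folklore] -/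
theorem coe_sum_smul_residual (β : ℝ) {n : ℕ} (u : Fin n → physSubmodule L) (m : Fin n → ℝ) (c : Fin n → ℝ) :
    ((∑ i, c i • (transferOp β (u i) - m i • u i) : physSubmodule L) : GaugeConfig 3 L SU2 → ℝ) =
      ∑ i, c i • (transferApply β (u i : GaugeConfig 3 L SU2 → ℝ) - m i • (u i : GaugeConfig 3 L SU2 → ℝ)) := by
  rw [Submodule.coe_sum]
  refine Finset.sum_congr rfl fun i _ => ?_
  rw [Submodule.coe_smul, Submodule.coe_sub, Submodule.coe_smul, coe_transferOp]

/-- The underlying function of one packaged residual `K V − d V`. [folklore] -/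
theorem coe_residual (β d : ℝ) (V : physSubmodule L) :
    ((transferOp β V - d • V : physSubmodule L) : GaugeConfig 3 L SU2 → ℝ) =
      transferApply β (V : GaugeConfig 3 L SU2 → ℝ) - d • (V : GaugeConfig 3 L SU2 → ℝ) := by
  rw [Submodule.coe_sub, Submodule.coe_smul, coe_transferOp]

/-! ## §3 `RitzGeneratorsAt k → DressedRitzAt k`: Ritz rotation + in-span Courant–Fischer + LEMMA A -/

/-- ★ **The generator form implies the level-`k` slice of item 20205.**  Given generators `v` (g1)–(g4) at `(L, β)`: the Gram matrix is positive definite (g1), so the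
span carries an `l2`-orthonormal `qform`-diagonal basis `u` with decreasing Ritz data `m` (`exists_orthonormal_formDiagonal_antitone`); by in-span
Courant–Fischer `ritzValue β v j = m_j` (`ritzValue_eq_ritzDiag`), so (g3) is clause (i) and (g4) is clause (iii) for `φ = u`; LEMMA A with `g = 1/2`,
`n = k+1`, `ρ = max C 0 · (λ³/L²) m₀²` turns (g2) into the residual Gram bound (ii′) with constant `2(k+1)·max C 0`. [cite: LuscherWolff1990] -/
theorem dressedRitzAt_of_ritzGeneratorsAt {k : ℕ} (h : RitzGeneratorsAt k) : DressedRitzAt k := by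
  intro η hη
  obtain ⟨C, lam0, hlam0, hC⟩ := h η hη
  set C' : ℝ := max C 0 with hC'def
  have hC'0 : 0 ≤ C' := le_max_right C 0
  have hCC' : C ≤ C' := le_max_left C 0
  set CD : ℝ := 2 * ((k : ℝ) + 1) * C' with hCDdef
  have hC'CD : C' ≤ CD := by
    rw [hCDdef]
    exact le_mul_of_one_le_left hC'0 (by have := (Nat.cast_nonneg k : (0 : ℝ) ≤ k); linarith)
  have hCCD : C ≤ CD := hCC'.trans hC'CD
  refine ⟨CD, lam0, hlam0, fun lam hlam hle => ?_⟩
  obtain ⟨L0, hL0⟩ := hC lam hlam hle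
  refine ⟨L0, fun L _ hL β hW => ?_⟩
  obtain ⟨v, hphys, hnorm, hgram, hres, hritz, htop⟩ := hL0 L hL β hW
  have hβ1 : (1 : ℝ) ≤ β := hW.1
  have hβ0 : (0 : ℝ) ≤ β := zero_le_one.trans hβ1
  have hx0 : 0 ≤ luscherLambda β L := luscherLambda_nonneg β L
  have hs0 : 0 ≤ luscherLambda β L ^ 2 / (L : ℝ) := div_nonneg (sq_nonneg _) (Nat.cast_nonneg L)
  have hx3 : 0 ≤ luscherLambda β L ^ 3 / (L : ℝ) ^ 2 := div_nonneg (pow_nonneg hx0 3) (sq_nonneg _)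
  -- the packaged family and the operator-free data
  let V : Fin (k + 1) → physSubmodule L := fun i => ⟨v i, hphys i⟩
  have hVv : (fun i => (V i : GaugeConfig 3 L SU2 → ℝ)) = v := rfl
  set ip := l2Form L with hip
  set K := transferOp (L := L) β with hK
  set E : physSubmodule L →ₗ[ℝ] physSubmodule L →ₗ[ℝ] ℝ := ip.compl₂ K with hE
  have hE_apply : ∀ x y, E x y = ip x (K y) := fun x y => LinearMap.compl₂_apply _ _ _ _
  have hip_symm : ∀ x y, ip x y = ip y x := l2Form_symm
  have hip_nonneg : ∀ x, 0 ≤ ip x x := l2Form_self_nonneg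
  have hKsymm : ∀ x y, ip (K x) y = ip x (K y) := transferOp_symm β
  have hE_symm : ∀ x y, E x y = E y x := fun x y => by
    rw [hE_apply, hE_apply, ← hKsymm, hip_symm]
  -- (g1) ⇒ the Gram matrix is positive definite, with conditioning `1/2`
  have hgram' : ∀ b : Fin (k + 1) → ℝ, (1 / 2 : ℝ) * ∑ l, b l ^ 2 ≤ ip (∑ l, b l • V l) (∑ l, b l • V l) := by
    intro b
    rw [hip, l2Form_apply, coe_sum_smul]
    have := hgram b
    linarith
  have hG : (Matrix.of fun i l => ip (V i) (V l)).PosDef := by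
    refine Matrix.posDef_iff_dotProduct_mulVec.mpr ⟨?_, fun c hc => ?_⟩
    · ext i l
      simp only [Matrix.conjTranspose_apply, Matrix.of_apply, star_trivial, hip_symm (V l) (V i)]
    · have hquad : dotProduct (star c) (Matrix.mulVec (Matrix.of fun i l => ip (V i) (V l)) c) =
          ip (∑ i, c i • V i) (∑ l, c l • V l) := by
        rw [bilin_sum_smul_sum_smul, star_trivial, dotProduct]
        refine Finset.sum_congr rfl fun i _ => ?_
        rw [Matrix.mulVec, dotProduct, Finset.mul_sum]
        refine Finset.sum_congr rfl fun l _ => ?_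
        simp only [Matrix.of_apply]
        ring
      rw [hquad]
      have hpos : 0 < ∑ i, c i ^ 2 := by
        obtain ⟨i, hi⟩ : ∃ i, c i ≠ 0 := by
          by_contra h0
          push Not at h0
          exact hc (funext h0)
        exact lt_of_lt_of_le (by positivity : 0 < c i ^ 2)
          (Finset.single_le_sum (fun l _ => sq_nonneg (c l)) (Finset.mem_univ i))
      have := hgram' c
      linarith
  -- Rayleigh–Ritz diagonalisation inside the span, sorted
  obtain ⟨u, m, hanti, hu', hon', hdiag'⟩ := exists_orthonormal_formDiagonal_antitone ip E hE_symm V hG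
  have hu : ∀ i, (u i : GaugeConfig 3 L SU2 → ℝ) ∈ Submodule.span ℝ (Set.range v) := fun i => by
    rw [← hVv, ← coe_mem_span_iff]; exact hu' i
  have hon : ∀ i l, l2 (u i : GaugeConfig 3 L SU2 → ℝ) (u l) = if i = l then 1 else 0 := fun i l => by
    rw [← l2Form_apply]; exact hon' i l
  have hdiag : ∀ i l, qform su2Rep β (u i : GaugeConfig 3 L SU2 → ℝ) (u l) = if i = l then m i else 0 := fun i l => by
    rw [← l2Form_transferOp_right, ← hE_apply]; exact hdiag' i l
  have hritz' : ∀ i l, ip (u i) (K (u l)) = if i = l then m i else 0 := fun i l => by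
    rw [← hE_apply]; exact hdiag' i l
  have hspan := span_coe_eq_span v u hu hon
  have hvu : ∀ l, V l ∈ Submodule.span ℝ (Set.range u) := fun l => by
    rw [coe_mem_span_iff, hspan]
    exact Submodule.subset_span ⟨l, rfl⟩
  have hq : ∀ i, qform su2Rep β (u i : GaugeConfig 3 L SU2 → ℝ) (u i) = m i := fun i => by rw [hdiag, if_pos rfl]
  have hm0 : ∀ i, 0 ≤ m i := fun i => by rw [← hq i]; exact qform_su2Rep_self_nonneg hβ0 (isPhys_coe _)
  -- in-span Courant–Fischer: the Ritz values of `v` ARE the sorted Ritz data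
  have hRj : ∀ j : Fin (k + 1), ritzValue β v j = m j := fun j => by
    have hj : (j : ℕ) ≤ k := Nat.le_of_lt_succ j.2
    have h := ritzValue_eq_ritzDiag hβ0 hphys hu hon hdiag hanti hj
    rw [Fin.eta] at h
    exact h
  have hR0 : ritzValue β v 0 = m 0 := by
    have h := hRj 0
    exact h
  -- the residual scale
  set ρ : ℝ := C' * (luscherLambda β L ^ 3 / (L : ℝ) ^ 2) * m 0 ^ 2 with hρdef
  have hρ0 : 0 ≤ ρ := mul_nonneg (mul_nonneg hC'0 hx3) (sq_nonneg _)
  have hres' : ∀ l, ip (K (V l) - qform su2Rep β (v l) (v l) • V l) (K (V l) - qform su2Rep β (v l) (v l) • V l) ≤ ρ := by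
    intro l
    rw [hip, l2Form_apply, hK, coe_residual]
    refine (hres l).trans ?_
    rw [hρdef, hR0]
    exact mul_le_mul_of_nonneg_right (mul_le_mul_of_nonneg_right hCC' hx3) (sq_nonneg _)
  -- one-site values are non-negative
  have hμ : ∀ j : ℕ, 0 ≤ levelValue su2Rep 1 (oneSiteCoupling β L) j := fun j =>
    levelValue_su2Rep_nonneg 1 (oneSiteCoupling_nonneg β L) j
  -- the witnesses
  refine ⟨fun i => (u i : GaugeConfig 3 L SU2 → ℝ), fun i => isPhys_coe (u i), hon, ?_, ?_, ?_, ?_, ?_⟩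
  · intro i l hil
    rw [hdiag, if_neg hil]
  · intro i l hil
    rw [hq, hq]
    exact hanti hil
  · intro j
    obtain ⟨h1, h2⟩ := hritz j (Nat.le_of_lt_succ j.2)
    rw [hRj, hR0] at h1 h2
    rw [hq, hq]
    exact ⟨le_exp_mul_div_of_le h1 hs0 (mul_nonneg (hμ j) (hm0 0)) hCCD,
      le_exp_mul_div_of_le h2 hs0 (mul_nonneg (hm0 j) (hμ 0)) hCCD⟩
  · intro c
    simp_rw [hq]
    rw [← coe_sum_smul_residual β u m c, ← l2Form_apply]
    have hA := residualGram_le_of_generators ip hip_symm hip_nonneg K hKsymm V (fun l => qform su2Rep β (v l) (v l)) u m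
      hon' hritz' hu' hvu (by norm_num : (0 : ℝ) < 1 / 2) hρ0 hgram' hres' c
    refine hA.trans (le_of_eq ?_)
    rw [hρdef]
    push_cast
    ring
  · intro ψ hψ
    rw [hq, ← hR0]
    exact htop ψ hψ

/-! ## §4 The converse `DressedRitzAt k → RitzGeneratorsAt k` and the equivalence -/

/-- **A dressed Ritz family is a generator family** (orthonormal ⇒ Gram `= 1`; the residual Gram bound at `c = e_i` is the per-generator
residual bound; `ritzValue β φ j = m_j` by in-span Courant–Fischer). [cite: LuscherWolff1990] -/
theorem ritzGeneratorsAt_of_dressedRitzAt {k : ℕ} (h : DressedRitzAt k) : RitzGeneratorsAt k := by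
  intro η hη
  obtain ⟨C, lam0, hlam0, hC⟩ := h η hη
  refine ⟨C, lam0, hlam0, fun lam hlam hle => ?_⟩
  obtain ⟨L0, hL0⟩ := hC lam hlam hle
  refine ⟨L0, fun L _ hL β hW => ?_⟩
  obtain ⟨φ, hphys, hon, hoff, hanti, hratio, hres, htop⟩ := hL0 L hL β hW
  have hβ1 : (1 : ℝ) ≤ β := hW.1
  have hβ0 : (0 : ℝ) ≤ β := zero_le_one.trans hβ1
  -- packaged family, diagonal data
  let U : Fin (k + 1) → physSubmodule L := fun i => ⟨φ i, hphys i⟩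
  set m : Fin (k + 1) → ℝ := fun i => qform su2Rep β (φ i) (φ i) with hmdef
  have hu : ∀ i, (U i : GaugeConfig 3 L SU2 → ℝ) ∈ Submodule.span ℝ (Set.range φ) := fun i =>
    Submodule.subset_span ⟨i, rfl⟩
  have honU : ∀ i l, l2 (U i : GaugeConfig 3 L SU2 → ℝ) (U l) = if i = l then 1 else 0 := hon
  have hdiag : ∀ i l, qform su2Rep β (U i : GaugeConfig 3 L SU2 → ℝ) (U l) = if i = l then m i else 0 := by
    intro i l
    by_cases hil : i = l
    · subst hil; simp [hmdef, U]
    · rw [if_neg hil]; exact hoff i l hil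
  have hantim : Antitone m := fun i l hil => hanti i l hil
  have hRj : ∀ (j : ℕ) (hj : j ≤ k), ritzValue β φ j = m ⟨j, Nat.lt_succ_of_le hj⟩ := fun j hj =>
    ritzValue_eq_ritzDiag hβ0 hphys hu honU hdiag hantim hj
  have hR0 : ritzValue β φ 0 = m 0 := hRj 0 (Nat.zero_le k)
  have hm0eq : m 0 = qform su2Rep β (φ 0) (φ 0) := rfl
  refine ⟨φ, hphys, fun i => by rw [hon, if_pos rfl], ?_, ?_, ?_, ?_⟩
  · -- (g1): `‖Σ c_i φ_i‖² = Σ c_i²`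
    intro c
    have hcoe : (∑ i, c i • φ i) = ((∑ i, c i • U i : physSubmodule L) : GaugeConfig 3 L SU2 → ℝ) := by
      rw [coe_sum_smul]
    have hval : l2 (∑ i, c i • φ i) (∑ i, c i • φ i) = ∑ i, c i ^ 2 := by
      rw [hcoe, ← l2Form_apply, bilin_sum_smul_sum_smul]
      refine Finset.sum_congr rfl fun i _ => ?_
      simp only [l2Form_apply, honU, mul_ite, mul_one, mul_zero, Finset.sum_ite_eq, Finset.mem_univ, if_true]
      ring
    rw [hval]
    have : 0 ≤ ∑ i, c i ^ 2 := Finset.sum_nonneg fun i _ => sq_nonneg (c i)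
    linarith
  · -- (g2): the residual Gram bound at `c = e_i`
    intro i
    classical
    have h := hres (fun l => if l = i then 1 else 0)
    have hsum : (∑ l, (fun l => if l = i then (1 : ℝ) else 0) l •
        (transferApply β (φ l) - qform su2Rep β (φ l) (φ l) • φ l)) =
        transferApply β (φ i) - qform su2Rep β (φ i) (φ i) • φ i := by
      simp only [ite_smul, one_smul, zero_smul, Finset.sum_ite_eq', Finset.mem_univ, if_true]
    have hsq : (∑ l, ((fun l => if l = i then (1 : ℝ) else 0) l) ^ 2) = 1 := by
      rw [Finset.sum_eq_single i]
      · simp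
      · intro l _ hli; simp [hli]
      · intro hi; exact absurd (Finset.mem_univ i) hi
    rw [hsum, hsq, mul_one] at h
    rw [hR0, hm0eq]
    exact h
  · -- (g3)
    intro j hj
    obtain ⟨h1, h2⟩ := hratio ⟨j, Nat.lt_succ_of_le hj⟩
    rw [hRj j hj, hR0, hm0eq]
    exact ⟨h1, h2⟩
  · -- (g4)
    intro ψ hψ
    rw [hR0, hm0eq]
    exact htop ψ hψ

/-- **`RitzGeneratorsAt k ↔ DressedRitzAt k`** (level by level). [cite: LuscherWolff1990] -/
theorem ritzGeneratorsAt_iff_dressedRitzAt (k : ℕ) : RitzGeneratorsAt k ↔ DressedRitzAt k :=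
  ⟨dressedRitzAt_of_ritzGeneratorsAt, ritzGeneratorsAt_of_dressedRitzAt⟩

/-! ## §5 The route decl from generators at every level -/

/-- ★ **`(∀ k, RitzGeneratorsAt k) → Theses.LuscherReduction.DressedRitz`** (item stmt-QuantumFields-20205, BY NAME; `= ∀ k, DressedRitzAt k`
definitionally). [cite: LuscherWolff1990] -/
theorem dressedRitz_of_ritzGenerators (h : ∀ k : ℕ, RitzGeneratorsAt k) :
    Summit.QuantumFields.YangMills.Theses.LuscherReduction.DressedRitz :=
  fun k => dressedRitzAt_of_ritzGeneratorsAt (h k)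

/-- **`(∀ k, RitzGeneratorsAt k) ↔ Theses.LuscherReduction.DressedRitz`** — the generator ∕ GEVP form is an EQUIVALENT re-typing of item 20205.
[cite: LuscherWolff1990] -/
theorem ritzGenerators_iff_dressedRitz :
    (∀ k : ℕ, RitzGeneratorsAt k) ↔ Summit.QuantumFields.YangMills.Theses.LuscherReduction.DressedRitz :=
  ⟨dressedRitz_of_ritzGenerators, fun h k => ritzGeneratorsAt_of_dressedRitzAt (h k)⟩

end Summit.QuantumFields.YangMills.Theorems.FemtoTransferGap.KTGen

end
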